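import Summits.CriticalPhenomena.PercolationContinuityZ3.Theorems.Transplant.Z3RungDilutedAudit
import Mathlib.Tactic.FinCases
import HarnessLib

/-!
# Periodic nets on `ℤ³`, X — WHERE THE `{±1}` / `(ℤ/2)²` INTERFACES STOP: the ROW-DILUTED stackings `R_k` (square layers, rungs `{x, x ± e₂}` over
# the rows `x₀ ≡ 0 (mod k)` only).  `R_1 = pcu`, `R_2 =` the striped net (`θ(p_c) = 0`, file IV); for `k ≥ 3`, **`R_k` carries NO `PlanarSkeletonNeg`
# AT ALL — for ANY chart and ANY base set** (kernel negative): a STABILISER OBSTRUCTION — a base vertex of degree `4` whose unique degree-`6` neighbour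
# is fixed by every automorphism fixing it cannot carry the central inversion (that neighbour moves the chart, (ι), but would have to be reversed)

builds on p205010 (kernel theorem, internal audit signed; external expert review pending) — only `rowNet_two_criticalContinuity` (= file IV's
`striped_criticalContinuity`) uses it; the negatives use nothing of it.
Lane `prim-bschramm`, seat `prim-bschramm-p2` (gen 12; class C1b); helper file (`--supports stmt-CriticalPhenomena-4575 --as helper`).  Memo:
`HOME/bschramm/P2-LATTICES.md` §36 (7)/(9).  Pattern: p2-g10's `SkeletonDegreeObstruction` (degree `≤ 3` kills the interfaces); here the degree is `4`
everywhere off the rung rows and the obstruction is the STABILISER.  So `R_k`, `k ≥ 3` (quasi-transitive, `p_c < 1`, `θ(p_c) = 0` surely expected) is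
outside the reach of BOTH D″ nodes and of the `{±1}` node N1 — not for want of a proof of a node but for want of the interface; recorded for the planners.
* §1 `rowNet k` (the net), `mem_rowSteps_iff`, degrees `rowNet_degree_of_dvd` (`= 6`) / `_of_not_dvd` (`= 4`), `rowNet_degree_eq_six_iff`;
* §2 GENERIC: `PlanarSkeletonNeg.φ_ne_of_adj_of_degree_eq_four` (at a degree-4 vertex every neighbour moves the chart),
  **`PlanarSkeletonNeg.false_of_rigid_neighbour`** (a base vertex of degree 4 with a neighbour fixed by its whole stabiliser is impossible);
* §3 **`rowNet_isEmpty_skeletonNeg (hk : 3 ≤ k) : IsEmpty (PlanarSkeletonNeg (rowNet k).graph)`** (+ `Sign`, + no `SignData`);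
* §4 `rowNet_two_graph : (rowNet 2).graph = striped.net.graph`, **`rowNet_two_criticalContinuity`** (the `k = 2` member IS covered).
[cite: KozmaNitzan2024, §4 p. 16 (Lemma 8: the lattice symmetries)] [cite: BenjaminiSchramm1996, §2, Conj. 4]
-/

noncomputable section

namespace Summit.CriticalPhenomena.PercolationContinuityZ3.Theorems.Transplant

open MeasureTheory Literature.Probability.Percolation Literature.Probability.LatticeModels SimpleGraph
open Z3Diag (ev proj)
open scoped Classical

namespace Z3Net

/-! ## §1 The row-diluted stackings -/

/-- The steps of `R_k` at `x`: `±e₀, ±e₁` always, `±e₂` iff `k ∣ x₀` (whole vertical lines of rungs over every `k`-th row). [folklore] -/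
def rowSteps (k : ℕ) (x : Site 3) : Finset (Site 3) :=
  {ev 0, -ev 0, ev 1, -ev 1} ∪ (if (k : ℤ) ∣ x 0 then {ev 2, -ev 2} else ∅)

/-- Membership in `rowSteps`. [folklore] -/
theorem mem_rowSteps_iff {k : ℕ} {x s : Site 3} :
    s ∈ rowSteps k x ↔ (s = ev 0 ∨ s = -ev 0 ∨ s = ev 1 ∨ s = -ev 1) ∨ ((k : ℤ) ∣ x 0 ∧ (s = ev 2 ∨ s = -ev 2)) := by
  rw [rowSteps, Finset.mem_union]
  simp only [Finset.mem_insert, Finset.mem_singleton]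
  split_ifs with h <;> simp [h]

/-- **The row-diluted stacking `R_k`** as a net on `ℤ³`. [cite: BenjaminiSchramm1996, §2] -/
def rowNet (k : ℕ) : Z3Net where
  stepsAt := rowSteps k
  zero_notMem x := by
    rw [mem_rowSteps_iff]
    rintro ((h | h | h | h) | ⟨-, h | h⟩)
    · exact (RungPattern.zero_ne_ev 0).1 h
    · exact (RungPattern.zero_ne_ev 0).2 h
    · exact (RungPattern.zero_ne_ev 1).1 h
    · exact (RungPattern.zero_ne_ev 1).2 h
    · exact (RungPattern.zero_ne_ev 2).1 h
    · exact (RungPattern.zero_ne_ev 2).2 h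
  symm x s hs := by
    rw [mem_rowSteps_iff] at hs ⊢
    rcases hs with (rfl | rfl | rfl | rfl) | ⟨hx, rfl | rfl⟩
    · exact Or.inl (Or.inr (Or.inl rfl))
    · exact Or.inl (Or.inl (neg_neg _))
    · exact Or.inl (Or.inr (Or.inr (Or.inr rfl)))
    · exact Or.inl (Or.inr (Or.inr (Or.inl (neg_neg _))))
    · exact Or.inr ⟨by simpa [ev] using hx, Or.inr rfl⟩
    · exact Or.inr ⟨by simpa [ev] using hx, Or.inl (neg_neg _)⟩

/-- The steps of `R_k`. [folklore] -/
@[simp] theorem rowNet_stepsAt (k : ℕ) (x : Site 3) : (rowNet k).stepsAt x = rowSteps k x := rfl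

/-- **Degree `6` on the rung rows.** [folklore] -/
theorem rowNet_degree_of_dvd {k : ℕ} {x : Site 3} (hx : (k : ℤ) ∣ x 0) : (rowNet k).graph.degree x = 6 := by
  rw [Z3Net.degree_eq, rowNet_stepsAt, rowSteps, if_pos hx]
  decide

/-- **Degree `4` off the rung rows.** [folklore] -/
theorem rowNet_degree_of_not_dvd {k : ℕ} {x : Site 3} (hx : ¬ (k : ℤ) ∣ x 0) : (rowNet k).graph.degree x = 4 := by
  rw [Z3Net.degree_eq, rowNet_stepsAt, rowSteps, if_neg hx]
  decide

/-- Degree `6` characterises the rung rows. [folklore] -/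
theorem rowNet_degree_eq_six_iff {k : ℕ} {x : Site 3} : (rowNet k).graph.degree x = 6 ↔ (k : ℤ) ∣ x 0 := by
  by_cases hx : (k : ℤ) ∣ x 0
  · simp [rowNet_degree_of_dvd hx, hx]
  · simp [rowNet_degree_of_not_dvd hx, hx]

/-! ## §2 The stabiliser obstruction (generic) -/

end Z3Net

namespace PlanarSkeletonNeg

variable {V : Type} {G : SimpleGraph V} [G.LocallyFinite] (Φ : PlanarSkeletonNeg G)

/-- **At a vertex of degree `4` every neighbour moves the chart**: the four outward steps of (ι) exhaust the neighbourhood.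
[cite: KozmaNitzan2024, §4 p. 15] -/
theorem φ_ne_of_adj_of_degree_eq_four {v w : V} (hv : G.degree v = 4) (hw : G.Adj v w) : Φ.φ w ≠ Φ.φ v := by
  obtain ⟨a, ha, hφa⟩ := Φ.step v 0 1
  obtain ⟨b, hb, hφb⟩ := Φ.step v 0 (-1)
  obtain ⟨c, hc, hφc⟩ := Φ.step v 1 1
  obtain ⟨d, hd, hφd⟩ := Φ.step v 1 (-1)
  have h0 : ∀ {x y : V}, Φ.φ x ≠ Φ.φ y → x ≠ y := fun h hxy => h (hxy ▸ rfl)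
  have e00 := congrFun hφa 0; have e01 := congrFun hφa 1
  have e10 := congrFun hφb 0; have e11 := congrFun hφb 1
  have e20 := congrFun hφc 0; have e21 := congrFun hφc 1
  have e30 := congrFun hφd 0; have e31 := congrFun hφd 1
  simp only [Pi.add_apply, Pi.single_eq_same, Pi.single_eq_of_ne (one_ne_zero : (1 : Fin 2) ≠ 0),
    Pi.single_eq_of_ne (zero_ne_one : (0 : Fin 2) ≠ 1), Units.val_one, Units.val_neg] at e00 e01 e10 e11 e20 e21 e30 e31
  have hab : a ≠ b := h0 fun h => by have := congrFun h 0; omega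
  have hac : a ≠ c := h0 fun h => by have := congrFun h 0; omega
  have had : a ≠ d := h0 fun h => by have := congrFun h 0; omega
  have hbc : b ≠ c := h0 fun h => by have := congrFun h 0; omega
  have hbd : b ≠ d := h0 fun h => by have := congrFun h 0; omega
  have hcd : c ≠ d := h0 fun h => by have := congrFun h 1; omega
  have hsub : ({a, b, c, d} : Finset V) ⊆ G.neighborFinset v := by
    intro x hx
    rw [mem_neighborFinset]
    simp only [Finset.mem_insert, Finset.mem_singleton] at hx
    rcases hx with rfl | rfl | rfl | rfl <;> assumption
  have hcard : ({a, b, c, d} : Finset V).card = 4 := by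
    rw [Finset.card_insert_of_notMem (by simp [hab, hac, had]), Finset.card_insert_of_notMem (by simp [hbc, hbd]),
      Finset.card_insert_of_notMem (by simp [hcd]), Finset.card_singleton]
  have heq : ({a, b, c, d} : Finset V) = G.neighborFinset v :=
    Finset.eq_of_subset_of_card_le hsub (by rw [card_neighborFinset_eq_degree, hv, hcard])
  have hw' : w ∈ ({a, b, c, d} : Finset V) := by rw [heq, mem_neighborFinset]; exact hw
  simp only [Finset.mem_insert, Finset.mem_singleton] at hw'
  intro hφw
  rcases hw' with rfl | rfl | rfl | rfl
  · have := congrFun hφw 0; omega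
  · have := congrFun hφw 0; omega
  · have := congrFun hφw 1; omega
  · have := congrFun hφw 1; omega

/-- **THE STABILISER OBSTRUCTION**: a base vertex `t` of degree `4` with a neighbour `w` fixed by every automorphism fixing `t` is impossible — the
central inversion at `t` fixes `w`, so `φ w − φ t = −(φ w − φ t)`, i.e. `φ w = φ t`, against (ι). [cite: KozmaNitzan2024, §4 p. 16 (Lemma 8)] -/
theorem false_of_rigid_neighbour {t w : V} (ht : t ∈ Φ.types) (hdeg : G.degree t = 4) (hw : G.Adj t w)
    (hrigid : ∀ ρ : G ≃g G, ρ t = t → ρ w = w) : False := by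
  obtain ⟨ρ, hρt, hρ⟩ := Φ.neg t ht
  have h := hρ w
  rw [hrigid ρ hρt] at h
  refine Φ.φ_ne_of_adj_of_degree_eq_four hdeg hw ?_
  funext i
  have hi := congrFun h i
  simp only [Pi.sub_apply, Pi.neg_apply] at hi
  omega

end PlanarSkeletonNeg

namespace Z3Net

/-! ## §3 For `k ≥ 3`, `R_k` carries no planar skeleton with a central inversion -/

/-- The neighbours of `e₀` in `R_k`, `k ≥ 2`: the four in-layer ones (the row `x₀ = 1` carries no rung). [folklore] -/
theorem rowNet_adj_ev_zero_iff {k : ℕ} (hk : 2 ≤ k) (w : Site 3) :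
    (rowNet k).graph.Adj (ev 0) w ↔ w = ev 0 + ev 0 ∨ w = 0 ∨ w = ev 0 + ev 1 ∨ w = ev 0 - ev 1 := by
  have h1 : ¬ (k : ℤ) ∣ (ev 0 : Site 3) 0 := by
    simp only [ev, Pi.single_eq_same]
    intro h; have := Int.le_of_dvd one_pos h; omega
  rw [Z3Net.graph_adj_iff, rowNet_stepsAt, mem_rowSteps_iff]
  simp only [h1, false_and, or_false, sub_eq_iff_eq_add']
  have e2 : ev 0 + -ev 0 = (0 : Site 3) := by rw [add_neg_cancel]
  have e4 : ev 0 + -ev 1 = (ev 0 - ev 1 : Site 3) := by rw [sub_eq_add_neg]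
  rw [e2, e4]

/-- In `R_k`, `k ≥ 3`, the ONLY degree-`6` neighbour of `e₀` is `0`. [folklore] -/
theorem rowNet_eq_zero_of_adj_ev_zero {k : ℕ} (hk : 3 ≤ k) {w : Site 3} (h1 : (rowNet k).graph.Adj (ev 0) w)
    (h2 : (rowNet k).graph.degree w = 6) : w = 0 := by
  rw [rowNet_degree_eq_six_iff] at h2
  rcases (rowNet_adj_ev_zero_iff (by omega) w).1 h1 with rfl | rfl | rfl | rfl
  · exfalso; simp [ev] at h2; have := Int.le_of_dvd two_pos h2; omega
  · rfl
  · exfalso; simp [ev] at h2; have := Int.le_of_dvd one_pos h2; omega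
  · exfalso; simp [ev] at h2; have := Int.le_of_dvd one_pos h2; omega

/-- **KERNEL NEGATIVE: for `k ≥ 3` the row-diluted stacking `R_k` carries NO `PlanarSkeletonNeg` — for any chart, any base set.**  A frame carries
some base vertex `t` onto `e₀` (degree 4, unique degree-6 neighbour `0`); conjugating, every automorphism fixing `t` fixes the corresponding neighbour
of `t`; the stabiliser obstruction applies. [cite: KozmaNitzan2024, §4 p. 16 (Lemma 8)] -/
theorem rowNet_isEmpty_skeletonNeg {k : ℕ} (hk : 3 ≤ k) : IsEmpty (PlanarSkeletonNeg (rowNet k).graph) := by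
  refine ⟨fun Φ => ?_⟩
  obtain ⟨t, ht, α, hαt, -⟩ := Φ.frame (ev 0)
  have hk1 : ¬ (k : ℤ) ∣ (ev 0 : Site 3) 0 := by
    simp only [ev, Pi.single_eq_same]
    intro h; have := Int.le_of_dvd one_pos h; omega
  have hdeg : (rowNet k).graph.degree t = 4 := by
    rw [← α.degree_eq t, hαt]; exact rowNet_degree_of_not_dvd hk1
  have hadj0 : (rowNet k).graph.Adj (ev 0) 0 := ((rowNet_adj_ev_zero_iff (by omega) 0).2 (Or.inr (Or.inl rfl)))
  have hadj : (rowNet k).graph.Adj t (α.symm 0) := by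
    rw [← α.map_adj_iff, hαt, RelIso.apply_symm_apply]; exact hadj0
  refine Φ.false_of_rigid_neighbour ht hdeg hadj fun ρ hρt => ?_
  have h1 : (rowNet k).graph.Adj (ev 0) (α (ρ (α.symm 0))) := by
    have h := α.map_adj_iff.2 (ρ.map_adj_iff.2 hadj)
    rwa [hρt, hαt] at h
  have h2 : (rowNet k).graph.degree (α (ρ (α.symm 0))) = 6 := by
    rw [α.degree_eq, ρ.degree_eq, α.symm.degree_eq]; exact rowNet_degree_of_dvd (by simp)
  have h3 := rowNet_eq_zero_of_adj_ev_zero hk h1 h2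
  have := congrArg α.symm h3
  rwa [RelIso.symm_apply_apply] at this

/-- **Corollary: for `k ≥ 3`, `R_k` carries no `PlanarSkeletonSign`** (the D″ interfaces). [cite: KozmaNitzan2024, §4 p. 16 (Lemma 8)] -/
theorem rowNet_isEmpty_skeletonSign {k : ℕ} (hk : 3 ≤ k) : IsEmpty (PlanarSkeletonSign (rowNet k).graph) :=
  ⟨fun Φ => (rowNet_isEmpty_skeletonNeg hk).false Φ.toPlanarSkeletonNeg⟩

/-- … in particular no `SignData` of `R_k`, `k ≥ 3`. [folklore] -/
theorem rowNet_isEmpty_signData {k : ℕ} (hk : 3 ≤ k) : IsEmpty (rowNet k).SignData :=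
  ⟨fun D => (rowNet_isEmpty_skeletonSign hk).false D.skeletonSign⟩

/-! ## §4 `k = 2` is the striped net: covered -/

/-- **`R_2` is the striped net of file IV.** [folklore] -/
theorem rowNet_two_graph : (rowNet 2).graph = RungPattern.striped.net.graph := by
  ext x y
  rw [Z3Net.graph_adj_iff, Z3Net.graph_adj_iff, rowNet_stepsAt, mem_rowSteps_iff, RungPattern.net_stepsAt, RungPattern.mem_stepsAt_iff]
  have e1 : RungPattern.striped.A x ↔ (2 : ℤ) ∣ x 0 := by
    show Even (x 0) ↔ _
    exact even_iff_two_dvd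
  have e2 : RungPattern.striped.A (x - ev 2) ↔ (2 : ℤ) ∣ x 0 := by
    show Even ((x - ev 2) 0) ↔ _
    simp [ev, even_iff_two_dvd]
  rw [e1, e2]
  simp only [Nat.cast_ofNat]
  tauto

/-- **`θ(v, p_c) = 0` on `R_2`** (= `striped_criticalContinuity`). builds on p205010 (kernel theorem, internal audit signed; external expert review
pending). [cite: BenjaminiSchramm1996, Conj. 4] -/
theorem rowNet_two_criticalContinuity (v : Site 3) : theta (rowNet 2).graph v (criticalProbIOf (rowNet 2).graph v) = 0 := by
  rw [rowNet_two_graph]; exact RungPattern.striped_criticalContinuity v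

end Z3Net

end Summit.CriticalPhenomena.PercolationContinuityZ3.Theorems.Transplant

end
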